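import Summits.BirchSwinnertonDyer.BirchSwinnertonDyer.Theorems.KolyvaginDepthDoorDepthTableIntrinsic
import Literature.NumberTheory.EllipticCurves.BurungaleSkinnerTianWan2024.CyclotomicPConverseSkinnerUrbanProofs
import Summits.BirchSwinnertonDyer.Rank1Residual.AdditivePotMult.QuadraticTwistTamagawaGood
import Summits.BirchSwinnertonDyer.Rank1Residual.AdditivePotMult.QuadraticBaseChangeOddTamagawaUnits
import Literature.NumberTheory.QuadraticFields.HeegnerCondition
import Literature.NumberTheory.EllipticCurves.HeegnerPointReflectionProofs
import Literature.NumberTheory.EllipticCurves.LeadingTermBSZOrdinaryProofs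
import HarnessLib

/-!
# Route `KolyvaginDepthDoor`, crux `KolyvaginDepthSupplyKN` (stmt-BirchSwinnertonDyer-22820) —
# DEPTH TABLE v16, GENERIC: the second road (W. Zhang 2014 Thm. 1.6, Beilinson–Flach-free) in INTRINSIC form —
# W. Zhang's Thm. 1.4 (2)–(3) for the Heegner twist READ ON THE CURVE

Helper file of the lead prover of line `levelone` (kdd-p1 g20; `--supports stmt-BirchSwinnertonDyer-22820
--as helper`); it closes nothing and BSD is NOT proved by it.

g19's second road (`…RankTwo<label>TwistBSDQuotientZhang`, 7 rows) certified W. Zhang's Thm. 1.4 (2)–(3) — «`ρ̄_{T,p}` ramified at every `ℓ ∥ N_T`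
with `ℓ ≡ ±1 (p)`; `Ram ≠ ∅`, and `#Ram = 1 ⟹ #{ℓ ∥ N_T}` even» — PER TWIST MODEL from its integer equation. For a Heegner twist they are the
curve's: for `K` Heegner for `N_E` with `d_K` odd square-free and `T` ANY globally minimal model of `E^{(d_K)}`,

  **the multiplicative primes of `T` are exactly those of `E`, with the same `ord_ℓ Δ_min`** (`multiplicative_iff_and_padicValInt_eq_of_heegnerTwist`):

at `ℓ ∣ N_E`, `ℓ` splits in `K`, so `d_K ∈ (ℚ_ℓ^×)²` and `T ⊗ ℚ_ℓ ≅ E ⊗ ℚ_ℓ` (tree theorem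
`BurungaleSkinnerTianWan2024.hasMultiplicativeReductionAtPrime_iff_and_padicValInt_eq_of_smul_eq_quadraticTwist_of_isSquare`); at `ℓ ∤ N_E d_K`
the twist is good (`d_K ≡ 1 (4)`: `AdditivePotMult.hasGoodReductionAt_quadraticTwist_of_emod_four`, `ℓ = 2` included); at `ℓ ∣ d_K` (odd) it is
additive (`AdditivePotMult.hasAdditiveReductionAt_and_ordMinimalDiscriminant_quadraticTwist_of_dvd_of_good`). Hence Zhang's (2) for `T` is
♠ (1) for `E`, and (3) for `T` (`N_T = N_E d_K²` is never square-free) holds as soon as `E` has TWO distinct multiplicative primes (then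
`#Ram(T) = #Ram(E) ≥ 2`) — ♠ (2)'s second clause.

* `natCard_selmerGroup_le_pow_succ_of_rankOne_bsdQuotient_zhang'` — Zhang's identity with tolerance `k` and NO Kodaira–Néron on `T`.
* `natCard_selmerGroup_quadraticTwist_le_of_bsdQuotient_intrinsic_zhang` — `#Sel_p(E^{(d_K)}) ≤ p^{k+1}` from the BSD-quotient valuation of
  ANY minimal twist model, every side condition on `E` (two multiplicative primes, ♠ (1) at `p`, `p ≥ 5` good ordinary, `ρ̄` onto), via W. Zhang
  2014 Thm. 1.6 instead of Burungale–Castella–Skinner.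
* `cruxBody_of_twistBSDQuotient_intrinsic_zhang` — the even-rank intrinsic mechanism on this road (♠ supply + Zhang Thm. 1.6): for the curves
  of the table with two multiplicative primes (`446d1`, `655a1`, `681c1`, `707a1`, `718b1`, `794a1`, `817a1`) a 2014, refereed, Beilinson–Flach-free
  road, now for EVERY odd Heegner field and EVERY admissible prime.

CONDITIONAL on Stein–Wuthrich 2013 Thm. 1.1, W. Zhang 2014 L8.4 (1) / 9.1 and Thm. 1.6, and GZK, BY NAME; per `(W, p, K)`; nothing class-wide on
the open stub (S♭); BSD is NOT proved by any of this.

References: [WZhang2014] Thm. 1.4 (2)–(3) (p. 197), Thm. 1.6 (p. 199), Lemma 8.4 (1), Thm. 9.1; [SteinWuthrich2013] Thm. 1.1; [Darmon2004] Thm. 3.22;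
[SilvermanAEC2009] VII.1 Rem. 1.1, VII.5 Prop. 5.1, X.5 Cor. 5.4; [NeukirchANT1999] Ch. II (4.6).
-/

set_option linter.dupNamespace false

noncomputable section

open scoped Classical NumberField

namespace Summit.BirchSwinnertonDyer.BirchSwinnertonDyer.Theorems.KolyvaginDepthDoor

open Literature.NumberTheory.EllipticCurves Literature.NumberTheory.EllipticCurves.ModularForms
  WeierstrassCurve NumberField IsDedekindDomain Rat.HeightOneSpectrum
open Literature.NumberTheory.EllipticCurves.Rank1Residual
open Summit.BirchSwinnertonDyer.BirchSwinnertonDyer.Theorems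
open Summit.BirchSwinnertonDyer.Rank1Residual

/-! ## The multiplicative primes of a Heegner twist are the curve's -/

/-- **The multiplicative primes of a Heegner twist are exactly the curve's, with the same `ord_ℓ Δ_min`.** `W/ℚ` globally minimal, `K`
imaginary quadratic with `d_K` odd and square-free, every prime of `N_E` split in `K` (Heegner); `T` any globally minimal model of `E^{(d_K)}`
(`C • T = W.quadraticTwist d_K`). THEN for every prime `ℓ`: `T` is multiplicative at `ℓ` iff `W` is, and then `ord_ℓ Δ_min(T) = ord_ℓ Δ_min(W)`.
At `ℓ ∣ N_E`: `d_K ∈ (ℚ_ℓ^×)²` (split prime), twist by a local square; at `ℓ ∤ N_E`, `ℓ ∤ d_K`: both good (`d_K ≡ 1 (4)`, unramified twist,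
`ℓ = 2` included); at `ℓ ∣ d_K`: `W` good (Heegner ⟹ `(d_K, N_E) = 1`) and the twist is ADDITIVE. [cite: SilvermanAEC2009, VII.5 Prop. 5.1, X.5 Cor. 5.4]
[cite: NeukirchANT1999, Ch. II (4.6)] [cite: WZhang2014, Thm. 1.4 (2)–(3) (p. 197)] -/
theorem multiplicative_iff_and_padicValInt_eq_of_heegnerTwist (W T : WeierstrassCurve ℚ) [W.IsElliptic] [W.IsGloballyMinimal]
    [T.IsElliptic] [T.IsGloballyMinimal] (K : Type) [Field K] [NumberField K] (hK : IsImaginaryQuadratic K)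
    (hodd : Odd (NumberField.discr K)) (hsqf : Squarefree (NumberField.discr K))
    [NeZero (W.conductorNorm ℤ)] (hH : SatisfiesHeegnerHypothesis (W.conductorNorm ℤ) K)
    {C : VariableChange ℚ} (hC : C • T = W.quadraticTwist (NumberField.discr K : ℚ)) (ℓ : ℕ) [hℓ : Fact ℓ.Prime] :
    (T.HasMultiplicativeReductionAtPrime ℓ ↔ W.HasMultiplicativeReductionAtPrime ℓ) ∧
      (W.HasMultiplicativeReductionAtPrime ℓ → padicValInt ℓ T.minimalDiscriminantInt = padicValInt ℓ W.minimalDiscriminantInt) := by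
  have hd0 : NumberField.discr K ≠ 0 := NumberField.discr_ne_zero K
  have hdq : (NumberField.discr K : ℚ) ≠ 0 := by exact_mod_cast hd0
  haveI := W.isElliptic_quadraticTwist hdq
  by_cases hN : ℓ ∣ W.conductorNorm ℤ
  · -- `ℓ ∣ N_E` splits in `K`: twist by a square of `ℚ_ℓ`
    have hsplit : ((Ideal.span {(ℓ : ℤ)}).primesOver (𝓞 K)).ncard = 2 := hH ℓ hℓ.out hN
    have hsq : IsSquare (((NumberField.discr K : ℚ) : ℚ) : ℚ_[ℓ]) :=
      Castella2018.TamagawaQuadratic.isSquare_padic_discr_of_splitsIn hK.1 hsplit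
    obtain ⟨hiff, hΔ⟩ :=
      BurungaleSkinnerTianWan2024.hasMultiplicativeReductionAtPrime_iff_and_padicValInt_eq_of_smul_eq_quadraticTwist_of_isSquare
        W T hdq hC ℓ hsq
    exact ⟨hiff, fun _ ↦ hΔ⟩
  · -- `ℓ ∤ N_E`: `W` is good at `ℓ`, and `T` is good (`ℓ ∤ d_K`) or additive (`ℓ ∣ d_K`) — never multiplicative
    have hgoodW : W.HasGoodReductionAtPrime ℓ := by
      by_contra h
      exact hN ((W.dvd_conductorNorm_iff_not_hasGoodReductionAtPrime ℓ).mpr h)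
    have hnotW : ¬ W.HasMultiplicativeReductionAtPrime ℓ := fun h ↦
      WeierstrassCurve.HasMultiplicativeReduction.not_hasGoodReduction (R := ℤ_[ℓ]) h hgoodW
    obtain ⟨v, hv⟩ : ∃ v : HeightOneSpectrum (𝓞 ℚ), (primesEquiv v : ℕ) = ℓ :=
      ⟨primesEquiv.symm ⟨ℓ, hℓ.out⟩, by rw [Equiv.apply_symm_apply]⟩
    have hgoodWv : W.HasGoodReductionAt v := (hasGoodReductionAtPrime_primesEquiv_iff_holds W v ℓ hv).mp hgoodW
    have hnotT : ¬ T.HasMultiplicativeReductionAtPrime ℓ := by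
      intro hT
      -- transport to the canonical twist at the place `v`
      have hT' : (W.quadraticTwist (NumberField.discr K : ℚ)).HasMultiplicativeReductionAtPrime ℓ := by
        rw [← hC]; exact (hasMultiplicativeReductionAtPrime_smul_iff T C ℓ).mpr hT
      have hTv : (W.quadraticTwist (NumberField.discr K : ℚ)).HasMultiplicativeReductionAt v := by
        have := (W.quadraticTwist (NumberField.discr K : ℚ)).hasMultiplicativeReductionAtPrime_iff_hasMultiplicativeReductionAt_ringOfIntegers v
        subst hv
        exact this.mp hT'
      by_cases hℓd : ((primesEquiv v : ℕ) : ℤ) ∣ NumberField.discr K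
      · -- `ℓ ∣ d_K` (odd, exactly once): the twist is additive at `v`
        have hv2 : (primesEquiv v : ℕ) ≠ 2 := by
          intro h2
          rw [h2] at hℓd
          obtain ⟨m, hm⟩ := hodd
          omega
        have h2 : ¬ ((primesEquiv v : ℕ) : ℤ) ^ 2 ∣ NumberField.discr K := by
          intro h
          have hprime : Prime ((primesEquiv v : ℕ) : ℤ) := Nat.prime_iff_prime_int.mp (primesEquiv v).2
          exact hprime.not_unit (hsqf _ (by simpa [sq] using h))
        have hadd := (AdditivePotMult.hasAdditiveReductionAt_and_ordMinimalDiscriminant_quadraticTwist_of_dvd_of_good W v hv2 hℓd h2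
          hgoodWv).2.1
        exact hadd.not_hasMultiplicativeReductionAt hTv
      · -- `ℓ ∤ d_K`: the twist is good at `v` (`d_K ≡ 1 (mod 4)`)
        have hd4 : NumberField.discr K % 4 = 1 := by
          rcases Literature.NumberTheory.QuadraticFields.Quadratic.discr_emod_four (K := K) hK.1 with h | h
          · exfalso; obtain ⟨m, hm⟩ := hodd; omega
          · exact h
        have hgoodTv := AdditivePotMult.hasGoodReductionAt_quadraticTwist_of_emod_four W v hd4 hℓd hgoodWv
        exact hgoodTv.not_hasMultiplicativeReductionAt hTv
    exact ⟨⟨fun h ↦ absurd h hnotT, fun h ↦ absurd h hnotW⟩, fun h ↦ absurd h hnotW⟩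

/-! ## Zhang's identity with tolerance and without Kodaira–Néron on the twist -/

/-- **EVEN rank, with tolerance, NO Kodaira–Néron hypothesis, W. ZHANG's road: `#Sel_p(T/ℚ) ≤ p^{k+1}` from `ord_p(L'(T,1)/(Ω_T·Reg_T)) ≤ k`**
(W. Zhang 2014 Thm. 1.6 + GZK by name; Zhang's Thm. 1.4 (2)–(3) as hypotheses on `T`). Zhang's identity `ord_p(quotient) = ord_p #Ш + ord_p Tam −
2 ord_p #tors`: the torsion term vanishes (`E[p]` irreducible), the Tamagawa term is `≥ 0`, so `ord_p #Ш(T) ≤ k` and `#Sel_p(T) ≤ p^{k+1}`.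
CONDITIONAL on the two named facts; per `(T, p)`; BSD is not proved by it. [cite: WZhang2014, Thm. 1.6 (p. 199), Thm. 1.4 (p. 197)]
[cite: Darmon2004, Thm. 3.22] [cite: SilvermanAEC2009, Thm. X.4.2] -/
theorem natCard_selmerGroup_le_pow_succ_of_rankOne_bsdQuotient_zhang'
    (hZ : WZhang2014_padicValRat_bsd_rank_one_ordinary) (hGZK : rank_eq_analyticRank_of_analyticRank_le_one)
    (T : WeierstrassCurve ℚ) [T.IsElliptic] [T.IsGloballyMinimal] (p : ℕ) [hp : Fact p.Prime] (h5 : 5 ≤ p)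
    (hgood : T.HasGoodReductionAtPrime p) (hord : ¬ (p : ℤ) ∣ T.frobeniusTrace p) (hsur : T.HasSurjectiveModNGaloisRep p)
    (h2 : ∀ (ℓ : ℕ) [Fact ℓ.Prime], T.HasMultiplicativeReductionAtPrime ℓ →
      (p ∣ ℓ - 1 ∨ p ∣ ℓ + 1) → ¬ p ∣ padicValInt ℓ T.minimalDiscriminantInt)
    (h3 : ¬ T.IsSemistable ℤ →
      (∃ ℓ : ℕ, ∃ _ : Fact ℓ.Prime, T.HasMultiplicativeReductionAtPrime ℓ ∧
          ¬ p ∣ padicValInt ℓ T.minimalDiscriminantInt) ∧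
        (Set.ncard {ℓ : ℕ | ∃ _ : Fact ℓ.Prime, T.HasMultiplicativeReductionAtPrime ℓ ∧
            ¬ p ∣ padicValInt ℓ T.minimalDiscriminantInt} = 1 →
          Even (Set.ncard {ℓ : ℕ | ∃ _ : Fact ℓ.Prime, T.HasMultiplicativeReductionAtPrime ℓ})))
    (hr : T.analyticRank = 1) (k : ℕ)
    (hval : ∀ q : ℚ, T.leadingLCoeff / ((T.realPeriodRat * T.regulator : ℝ) : ℂ) = (q : ℂ) → padicValRat p q ≤ k) :
    Nat.card (T.selmerGroup p) ≤ p ^ (k + 1) := by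
  have hirr : T.HasIrreducibleModPGaloisRep p := hasIrreducibleModPGaloisRep_of_hasSurjectiveModNGaloisRep T p hsur
  obtain ⟨hrank, hfin⟩ := hGZK T (by rw [hr])
  rw [hr] at hrank
  haveI : Finite T.sha := hfin
  obtain ⟨q, hq, hv⟩ := hZ T p h5 hgood hord hsur h2 h3 hr hfin
  have hq' : T.leadingLCoeff / ((T.realPeriodRat * T.regulator : ℝ) : ℂ) = (q : ℂ) := by
    rw [← hq]; push_cast; ring
  have hvk : padicValRat p q ≤ k := hval q hq'
  have htors : padicValNat p T.torsionOrder = 0 :=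
    Literature.NumberTheory.EllipticCurves.Rank1Residual.padicValNat_torsionOrder_eq_zero_of_irreducible T p hirr
  have hshak : padicValNat p T.shaOrder ≤ k := by
    have : ((padicValNat p T.shaOrder : ℕ) : ℤ) + ((padicValNat p T.tamagawaProduct : ℕ) : ℤ)
        - 2 * ((padicValNat p T.torsionOrder : ℕ) : ℤ) ≤ k := by rw [← hv]; exact hvk
    rw [htors] at this
    push_cast at this
    omega
  have htor : Nat.card (AddSubgroup.torsionBy T.toAffine.Point (p : ℤ)) = 1 :=
    natCard_torsionBy_eq_one_of_hasIrreducibleModPGaloisRep T p hirr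
  have hsha : Nat.card (T.sha ⊓ AddSubgroup.torsionBy T.galH1 (p : ℤ) : AddSubgroup T.galH1) ≤ p ^ k :=
    (natCard_sha_inf_torsionBy_le_pow_padicValNat T p).trans
      (Nat.pow_le_pow_right hp.out.pos (by rwa [WeierstrassCurve.shaOrder] at hshak))
  have h := T.natCard_selmerGroup_eq hp.out.ne_zero
  rw [hrank, pow_one] at h
  rw [h]
  have key : ∀ {t s : ℕ}, t = 1 → s ≤ p ^ k → p * t * s ≤ p ^ (k + 1) := by
    rintro t s rfl hs
    rw [mul_one, pow_succ']
    exact Nat.mul_le_mul_left _ hs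
  exact key (by convert htor) hsha

/-! ## The intrinsic twist bound on Zhang's road -/

/-- **`#Sel_p(E^{(d_K)}/ℚ) ≤ p^{k+1}` from ONE valuation on ANY minimal model of the twist — W. ZHANG's road, every side condition on `E`.**
`W` globally minimal with TWO distinct multiplicative primes and `p ∤ ord_ℓ Δ_min(W)` at every multiplicative `ℓ` (♠ (1)); `p ≥ 5` good
ordinary for `W`, `ρ̄_{W,p}` onto; `K` imaginary quadratic Heegner for `N_E`, `d_K` odd square-free, `p ∤ d_K`; `T` any globally minimal model of
`E^{(d_K)}`. IF `ord_{s=1} L(E^{(d_K)}, s) = 1` and `ord_p(L'(T,1)/(Ω_T Reg_T)) ≤ k`, THEN `#Sel_p(E^{(d_K)}/ℚ) ≤ p^{k+1}`: W. Zhang's (2)–(3) for `T`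
are READ ON `W` (`multiplicative_iff_and_padicValInt_eq_of_heegnerTwist`: same multiplicative primes, same exponents; `#Ram(T) = #Ram(W) ≥ 2`).
CONDITIONAL on W. Zhang 2014 Thm. 1.6 and GZK by name; BSD is not proved by it. [cite: WZhang2014, Thm. 1.6 (p. 199), Thm. 1.4 (2)–(3) (p. 197)]
[cite: Darmon2004, Thm. 3.22] -/
theorem natCard_selmerGroup_quadraticTwist_le_of_bsdQuotient_intrinsic_zhang
    (hZ : WZhang2014_padicValRat_bsd_rank_one_ordinary) (hGZK : rank_eq_analyticRank_of_analyticRank_le_one)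
    (W : WeierstrassCurve ℚ) [W.IsElliptic] [W.IsGloballyMinimal]
    (p : ℕ) [hp : Fact p.Prime] (h5 : 5 ≤ p) (hgood : W.HasGoodReductionAtPrime p)
    (hord : ¬ (p : ℤ) ∣ W.frobeniusTrace p) (hsur : W.HasSurjectiveModNGaloisRep p)
    (hS1 : ∀ (ℓ : ℕ) [Fact ℓ.Prime], W.HasMultiplicativeReductionAtPrime ℓ →
      ¬ p ∣ padicValInt ℓ W.minimalDiscriminantInt)
    (htwo : ∃ (ℓ₁ ℓ₂ : ℕ) (_ : Fact ℓ₁.Prime) (_ : Fact ℓ₂.Prime), ℓ₁ ≠ ℓ₂ ∧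
      W.HasMultiplicativeReductionAtPrime ℓ₁ ∧ W.HasMultiplicativeReductionAtPrime ℓ₂)
    (K : Type) [Field K] [NumberField K] (hK : IsImaginaryQuadratic K)
    (hodd : Odd (NumberField.discr K)) (hsqf : Squarefree (NumberField.discr K))
    (hpD : ¬ ((p : ℤ) ∣ NumberField.discr K))
    [NeZero (W.conductorNorm ℤ)] (hH : SatisfiesHeegnerHypothesis (W.conductorNorm ℤ) K)
    (T : WeierstrassCurve ℚ) [T.IsElliptic] [T.IsGloballyMinimal] (C : VariableChange ℚ)
    (hC : C • T = W.quadraticTwist (NumberField.discr K : ℚ))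
    (hTr : (W.quadraticTwist (NumberField.discr K : ℚ)).analyticRank = 1) (k : ℕ)
    (hval : ∀ q : ℚ, T.leadingLCoeff / ((T.realPeriodRat * T.regulator : ℝ) : ℂ) = (q : ℂ) → padicValRat p q ≤ k) :
    Nat.card ((W.quadraticTwist (NumberField.discr K : ℚ)).selmerGroup p) ≤ p ^ (k + 1) := by
  have hd0 : NumberField.discr K ≠ 0 := NumberField.discr_ne_zero K
  have hdq : (NumberField.discr K : ℚ) ≠ 0 := by exact_mod_cast hd0
  haveI := W.isElliptic_quadraticTwist hdq
  have hpP : p.Prime := hp.out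
  have hTsur : T.HasSurjectiveModNGaloisRep p := hasSurjectiveModNGaloisRep_of_smul_eq_quadraticTwist W T hdq hC p hsur
  have hp2d : ¬ ((p : ℤ) ∣ 2 * NumberField.discr K) := by
    intro h
    rcases (Nat.prime_iff_prime_int.mp hpP).dvd_or_dvd h with h2 | h2
    · have : p = 2 := (Nat.prime_dvd_prime_iff_eq hpP Nat.prime_two).mp (by exact_mod_cast h2)
      omega
    · exact hpD h2
  obtain ⟨hTgood, hTord⟩ := goodOrdinary_of_smul_eq_quadraticTwist_of_ne_zero W T hd0 hC p hp2d hgood hord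
  have hTr' : T.analyticRank = 1 := by rw [← hTr, ← hC, analyticRank_smul]
  -- the transfer of the multiplicative primes
  have key := fun (ℓ : ℕ) (i : Fact ℓ.Prime) ↦
    multiplicative_iff_and_padicValInt_eq_of_heegnerTwist W T K hK hodd hsqf hH hC ℓ
  -- Zhang's (2) for `T` from ♠ (1) for `W`
  have h2 : ∀ (ℓ : ℕ) [Fact ℓ.Prime], T.HasMultiplicativeReductionAtPrime ℓ →
      (p ∣ ℓ - 1 ∨ p ∣ ℓ + 1) → ¬ p ∣ padicValInt ℓ T.minimalDiscriminantInt := by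
    intro ℓ iℓ hT _
    have hW := (key ℓ iℓ).1.mp hT
    rw [(key ℓ iℓ).2 hW]
    exact hS1 ℓ hW
  -- the two `Ram` / `Mult` sets coincide with the curve's
  have hRam : {ℓ : ℕ | ∃ _ : Fact ℓ.Prime, T.HasMultiplicativeReductionAtPrime ℓ ∧
        ¬ p ∣ padicValInt ℓ T.minimalDiscriminantInt} =
      {ℓ : ℕ | ∃ _ : Fact ℓ.Prime, W.HasMultiplicativeReductionAtPrime ℓ ∧
        ¬ p ∣ padicValInt ℓ W.minimalDiscriminantInt} := by
    ext ℓ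
    simp only [Set.mem_setOf_eq]
    constructor
    · rintro ⟨iℓ, hT, hv⟩
      have hW := (key ℓ iℓ).1.mp hT
      exact ⟨iℓ, hW, by rw [← (key ℓ iℓ).2 hW]; exact hv⟩
    · rintro ⟨iℓ, hW, hv⟩
      exact ⟨iℓ, (key ℓ iℓ).1.mpr hW, by rw [(key ℓ iℓ).2 hW]; exact hv⟩
  -- `#Ram(W) ≥ 2`: the two multiplicative primes of `W` are ramified (♠ (1)), and `Ram(W)` is finite (`ℓ ∣ N_E`)
  obtain ⟨ℓ₁, ℓ₂, i₁, i₂, hne, hm₁, hm₂⟩ := htwo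
  have hfin : {ℓ : ℕ | ∃ _ : Fact ℓ.Prime, W.HasMultiplicativeReductionAtPrime ℓ ∧
      ¬ p ∣ padicValInt ℓ W.minimalDiscriminantInt}.Finite := by
    refine (Set.finite_le_nat (W.conductorNorm ℤ)).subset ?_
    rintro ℓ ⟨iℓ, hm, -⟩
    have hbad : ¬ W.HasGoodReductionAtPrime ℓ :=
      WeierstrassCurve.HasMultiplicativeReduction.not_hasGoodReduction (R := ℤ_[ℓ]) hm
    exact Nat.le_of_dvd (Nat.pos_of_ne_zero (NeZero.ne _))
      ((W.dvd_conductorNorm_iff_not_hasGoodReductionAtPrime ℓ).mpr hbad)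
  have htwo' : 1 < Set.ncard {ℓ : ℕ | ∃ _ : Fact ℓ.Prime, W.HasMultiplicativeReductionAtPrime ℓ ∧
      ¬ p ∣ padicValInt ℓ W.minimalDiscriminantInt} := by
    rw [Set.one_lt_ncard_iff hfin]
    exact ⟨ℓ₁, ℓ₂, ⟨i₁, hm₁, hS1 ℓ₁ hm₁⟩, ⟨i₂, hm₂, hS1 ℓ₂ hm₂⟩, hne⟩
  have h3 : ¬ T.IsSemistable ℤ →
      (∃ ℓ : ℕ, ∃ _ : Fact ℓ.Prime, T.HasMultiplicativeReductionAtPrime ℓ ∧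
          ¬ p ∣ padicValInt ℓ T.minimalDiscriminantInt) ∧
        (Set.ncard {ℓ : ℕ | ∃ _ : Fact ℓ.Prime, T.HasMultiplicativeReductionAtPrime ℓ ∧
            ¬ p ∣ padicValInt ℓ T.minimalDiscriminantInt} = 1 →
          Even (Set.ncard {ℓ : ℕ | ∃ _ : Fact ℓ.Prime, T.HasMultiplicativeReductionAtPrime ℓ})) := by
    intro _
    refine ⟨⟨ℓ₁, i₁, (key ℓ₁ i₁).1.mpr hm₁, by rw [(key ℓ₁ i₁).2 hm₁]; exact hS1 ℓ₁ hm₁⟩, fun h1 ↦ ?_⟩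
    rw [hRam] at h1
    omega
  have hSelT : Nat.card (T.selmerGroup p) ≤ p ^ (k + 1) :=
    natCard_selmerGroup_le_pow_succ_of_rankOne_bsdQuotient_zhang' hZ hGZK T p h5 hTgood hTord hTsur h2 h3 hTr' k hval
  rw [← natCard_selmerGroup_eq_of_variableChange (p : ℤ) hC]
  exact hSelT

/-- **THE INTRINSIC EVEN-RANK ROW MECHANISM ON W. ZHANG'S SECOND ROAD (Thm. 1.6, Beilinson–Flach-free)** — as
`cruxBody_of_twistBSDQuotient_intrinsic_spade` with Burungale–Castella–Skinner replaced by W. Zhang 2014 Thm. 1.6: `W` globally minimal, non-CM,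
`2 ≤ rank`, `N_E ≤ 30 000`, with TWO distinct multiplicative primes; `5 ≤ p < 1000` good ordinary, `ρ_{W,p^n}` onto, Kodaira–Néron, ♠ (1); `K`
imaginary quadratic Heegner with `d_K` odd square-free, `∉ {−3,−4}`, `p ∤ d_K`; `T` ANY globally minimal model of `E^{(d_K)}`; «`r_an(E^{(d_K)}) = 1
∧ ord_p(L'(T,1)/(Ω_T Reg_T)) ≤ k`», `k + 1 ≤ rank W` ⟹ the clause of `KolyvaginDepthSupplyKN` at `W` VERBATIM. CONDITIONAL on Stein–Wuthrich
Thm. 1.1, W. Zhang L8.4 (1) / 9.1 and Thm. 1.6, GZK by name; per `(W, p, K)`; nothing class-wide; BSD is not proved by it.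
[cite: SteinWuthrich2013, Thm. 1.1 (p. 1758)] [cite: WZhang2014, Thm. 1.6 (p. 199), Lemma 8.4 (1) (p. 236), Thm. 9.1 (p. 240)]
[cite: Darmon2004, Thm. 3.22] -/
theorem cruxBody_of_twistBSDQuotient_intrinsic_zhang
    (hSW : SteinWuthrich2013_sha_inf_torsionBy_eq_bot_of_two_le_rank)
    (h84 : Literature.NumberTheory.EllipticCurves.WZhang2014_lemma84_exists_minimal_kolyvaginClass_one_selmerCard)
    (hZ : WZhang2014_padicValRat_bsd_rank_one_ordinary) (hGZK : rank_eq_analyticRank_of_analyticRank_le_one)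
    (W : WeierstrassCurve ℚ) [W.IsElliptic] [W.IsGloballyMinimal] (hcm : ¬ W.HasCM) (hr : 2 ≤ W.mordellWeilRank)
    (hN : W.conductorNorm ℤ ≤ 30000)
    (p : ℕ) [hp : Fact p.Prime] (h5 : 5 ≤ p) (hp1000 : p < 1000) (hgood : W.HasGoodReductionAtPrime p)
    (hord : ¬ (p : ℤ) ∣ W.frobeniusTrace p)
    (htower : ∀ n : ℕ, W.HasSurjectiveModNGaloisRep (p ^ n : ℕ))
    (hKN : ∀ v : HeightOneSpectrum (𝓞 ℚ), W.HasMultiplicativeReductionAt v →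
      ¬ p ∣ W.ordMinimalDiscriminant v)
    (hS1 : ∀ (ℓ : ℕ) [Fact ℓ.Prime], W.HasMultiplicativeReductionAtPrime ℓ →
      ¬ p ∣ padicValInt ℓ W.minimalDiscriminantInt)
    (htwo : ∃ (ℓ₁ ℓ₂ : ℕ) (_ : Fact ℓ₁.Prime) (_ : Fact ℓ₂.Prime), ℓ₁ ≠ ℓ₂ ∧
      W.HasMultiplicativeReductionAtPrime ℓ₁ ∧ W.HasMultiplicativeReductionAtPrime ℓ₂)
    (K : Type) [Field K] [NumberField K] (hK : IsImaginaryQuadratic K)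
    (hodd : Odd (NumberField.discr K)) (hsqf : Squarefree (NumberField.discr K))
    (hD3 : NumberField.discr K ≠ -3) (hD4 : NumberField.discr K ≠ -4)
    (hpD : ¬ ((p : ℤ) ∣ NumberField.discr K))
    [iNZ : NeZero (W.conductorNorm ℤ)] (hH : SatisfiesHeegnerHypothesis (W.conductorNorm ℤ) K)
    (T : WeierstrassCurve ℚ) [T.IsElliptic] [T.IsGloballyMinimal] (C : WeierstrassCurve.VariableChange ℚ)
    (hC : C • T = W.quadraticTwist (NumberField.discr K : ℚ))
    (hTr : (W.quadraticTwist (NumberField.discr K : ℚ)).analyticRank = 1)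
    (k : ℕ) (hk : k + 1 ≤ W.mordellWeilRank)
    (hval : ∀ q : ℚ, T.leadingLCoeff / ((T.realPeriodRat * T.regulator : ℝ) : ℂ) = (q : ℂ) → padicValRat p q ≤ k) :
    ∃ (p : ℕ) (hp : Fact p.Prime), 5 ≤ p ∧ W.HasGoodReductionAtPrime p ∧
      ¬ (p : ℤ) ∣ W.frobeniusTrace p ∧ (∀ n : ℕ, W.HasSurjectiveModNGaloisRep (p ^ n : ℕ)) ∧
      (∀ v : HeightOneSpectrum (𝓞 ℚ), W.HasMultiplicativeReductionAt v →
        ¬ p ∣ W.ordMinimalDiscriminant v) ∧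
      ∃ (K : Type) (_ : Field K) (_ : NumberField K), IsImaginaryQuadratic K ∧
        NumberField.discr K ≠ -3 ∧ NumberField.discr K ≠ -4 ∧
        ∃ (_ : NeZero (W.conductorNorm ℤ)), SatisfiesHeegnerHypothesis (W.conductorNorm ℤ) K ∧
        ∃ (Dt : ModularParametrizationData W (W.conductorNorm ℤ)) (β : ℤ) (ι : K →+* ℂ) (n₁ : ℕ)
          (d : KolyvaginHeegnerData Dt β ι n₁), Squarefree n₁ ∧
          (∀ q ∈ n₁.primeFactors, Zhang2014.IsKolyvaginPrime (W.conductorNorm ℤ) W K p q) ∧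
          d.kolyvaginClass hp.out 1 ≠ 0 ∧
          (n₁.primeFactors.card + 1 ≤ W.mordellWeilRank ∨
            (n₁.primeFactors.card ≤ W.mordellWeilRank ∧
              n₁.primeFactors.card + 1 ≤ (W.quadraticTwist (NumberField.discr K : ℚ)).mordellWeilRank)) := by
  have hsur : W.HasSurjectiveModNGaloisRep p := by simpa only [pow_one] using htower 1
  have hS2 : ¬ Squarefree (W.conductorNorm ℤ) →
      (∃ (ℓ : ℕ) (_ : Fact ℓ.Prime), W.HasMultiplicativeReductionAtPrime ℓ ∧
          ¬ p ∣ padicValInt ℓ W.minimalDiscriminantInt) ∧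
        ∃ (ℓ₁ ℓ₂ : ℕ) (_ : Fact ℓ₁.Prime) (_ : Fact ℓ₂.Prime), ℓ₁ ≠ ℓ₂ ∧
          W.HasMultiplicativeReductionAtPrime ℓ₁ ∧ W.HasMultiplicativeReductionAtPrime ℓ₂ := by
    intro _
    obtain ⟨ℓ₁, ℓ₂, i₁, i₂, hne, hm₁, hm₂⟩ := htwo
    exact ⟨⟨ℓ₁, i₁, hm₁, hS1 ℓ₁ hm₁⟩, ℓ₁, ℓ₂, i₁, i₂, hne, hm₁, hm₂⟩
  have hSel := natCard_selmerGroup_quadraticTwist_le_of_bsdQuotient_intrinsic_zhang hZ hGZK W p h5 hgood hord hsur hS1 htwo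
    K hK hodd hsqf hpD hH T C hC hTr k hval
  exact cruxBody_of_twistSelmer_of_steinWuthrich hSW h84 W hcm hr hN p h5 hp1000 hgood hord htower hKN hS1 hS2
    K hK hD3 hD4 hpD hH (hSel.trans (Nat.pow_le_pow_right hp.out.pos hk))

end Summit.BirchSwinnertonDyer.BirchSwinnertonDyer.Theorems.KolyvaginDepthDoor

end
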